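import Summits.NavierStokesRegularity.NavierStokesRegularity.Theorems.SoloRefuteRamm2024Laplace
import Summits.NavierStokesRegularity.NavierStokesRegularity.Theorems.SoloRefuteRamm2024Grad
import Summits.NavierStokesRegularity.NavierStokesRegularity.Theorems.SoloSalvageRamm2024
import Literature.Barriers.NavierStokesRegularity.SmallDataGlobalRegularity
import Literature.Analysis.FluidPDE.VorticityStretching
import Literature.Analysis.FluidPDE.VectorCalculusProofs
import Literature.Analysis.FluidPDE.NSLerayHopfSereginEnergyProofs
import Mathlib.Analysis.Calculus.BumpFunction.Basic
import HarnessLib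

/-!
# NS-claims map (cell `ns-claims`, D-0090), claim C04 `Ramm2024`, part C: witness and verdict

A. G. Ramm, Modern Math. Methods 2 (2024) 19–26 (typed skeleton `Literature.Claims.NS.Ramm2024`; print
locators there). Third of three files (A: `SoloRefuteRamm2024Laplace.lean`, NS-free Laplace core; B:
`SoloRefuteRamm2024Grad.lean`, the bounds (W2)/(W3); both by ns-claims-typist-4's hand-over kit, adopted);
filed for ns-claims-refuter-2 by the cell's salvage prover under interim convention (b), content unchanged.

Main results (ns-claims-refuter-2):
* `exists_setting_ne_zero`: for every `ν > 0` there are `u₀ ≠ 0` and `(u, p)` with `Setting ν u₀ u p` —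
  an explicit compactly supported divergence-free test field `curl(φ e₃)` (`φ` a smooth bump), scaled into
  Kato's small-data range by the tree's `exists_clayA_smul` (Kato 1984: global smooth bounded-energy
  solution of the unforced system on `ℝ³ × [0,∞)`).
* `not_Step3_hyperSingularIneq : ¬ Step3_hyperSingularIneq` — **the first failing step** (inequality
  (1.19) p. 22 ≡ (1.29) p. 23, «b(t) ≤ b₀(t) − c·c₁·(Φ_{−1/4} ⋆ b)(t)» for every global solution in the
  setting): for the witness, `b ≥ β > 0` near `t = 0⁺` (W2, `b u 0 ≠ 0` by the salvage prover's
  kernel-discharged Step 7 `step7_dataZero_holds`, contrapositive) and `b₀ ≤ B` (W3), which the Laplace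
  core (part A) shows incompatible with (1.29). Class: false lemma (countermodel).
* downstream, by the same witness: `not_Step6_bZero` (Theorem 2.3 p. 25 «b(0) = 0» is false as a statement
  about all solutions in the setting) and `not_ClaimedTheorem` (the NSP paradox box p. 23 is false as typed:
  a nonzero smooth rapidly decaying divergence-free datum WITH a global smooth bounded-energy solution
  exists); `clayBreakdown_of_claimedTheorem` discharges the datum-existence hypothesis of the skeleton's
  Clay link `clay_of_claimed` (Δ8).
Axioms: `propext`, `Classical.choice`, `Quot.sound` only.
WHAT THIS IS NOT: not a claim about NS regularity or blow-up; not a claim about any author beyond the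
typed locator.
-/

-- The summit's canonical theorem namespace repeats the summit name (single-conjunct summit).
set_option linter.dupNamespace false

noncomputable section

open MeasureTheory Set Filter Real Function Metric
open scoped Topology ENNReal ContDiff

namespace Summit.NavierStokesRegularity.NavierStokesRegularity.Theorems.Ramm2024

open Literature.Claims.NS.Ramm2024 Literature.Analysis.FluidPDE Literature.Analysis.UnboundedOperators

/-! ### An explicit nonzero, compactly supported, divergence-free smooth field on `ℝ³` -/

/-- A smooth bump on `ℝ³`: `= 1` on the closed unit ball, `= 0` outside the ball of radius `2`. -/
def bump : ContDiffBump (0 : EuclideanSpace ℝ (Fin 3)) := ⟨1, 2, one_pos, one_lt_two⟩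

/-- The scalar bump as a function `φ`. -/
def bumpFn (x : EuclideanSpace ℝ (Fin 3)) : ℝ := bump x

/-- `φ` is smooth. -/
theorem contDiff_bumpFn : ContDiff ℝ ∞ bumpFn := bump.contDiff

/-- `φ` has compact support. -/
theorem hasCompactSupport_bumpFn : HasCompactSupport bumpFn := bump.hasCompactSupport

/-- The vector potential `φ e₃`. -/
def potential (x : EuclideanSpace ℝ (Fin 3)) : EuclideanSpace ℝ (Fin 3) :=
  bumpFn x • EuclideanSpace.single (2 : Fin 3) (1 : ℝ)

/-- The potential is smooth. -/
theorem contDiff_potential : ContDiff ℝ ∞ potential := contDiff_bumpFn.smul contDiff_const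

/-- The potential has compact support. -/
theorem hasCompactSupport_potential : HasCompactSupport potential :=
  hasCompactSupport_bumpFn.smul_right
    (f' := fun _ : EuclideanSpace ℝ (Fin 3) => EuclideanSpace.single (2 : Fin 3) (1 : ℝ))

/-- **The test datum** `curl (φ e₃) = (∂₂φ, −∂₁φ, 0)`. -/
def testDatum (x : EuclideanSpace ℝ (Fin 3)) : EuclideanSpace ℝ (Fin 3) := curl potential x

/-- The test datum is smooth. -/
theorem contDiff_testDatum : ContDiff ℝ ∞ testDatum :=
  contDiff_curl (n := ⊤) (contDiff_potential.of_le (by exact_mod_cast le_top))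

/-- The test datum has compact support. -/
theorem hasCompactSupport_testDatum : HasCompactSupport testDatum :=
  hasCompactSupport_curl hasCompactSupport_potential

/-- `div curl = 0`: the test datum is divergence free. -/
theorem isDivFree_testDatum : NSWave0.IsDivFree testDatum := fun x =>
  divergence_curl_eq_zero_holds potential (contDiff_infty.1 contDiff_potential 2) x

/-- The second component of the test datum: `(curl (φ e₃)) x 1 = −∂₁φ(x)`. -/
theorem testDatum_apply_one (x : EuclideanSpace ℝ (Fin 3)) :
    testDatum x 1 = -(fderiv ℝ bumpFn x (EuclideanSpace.single (0 : Fin 3) (1 : ℝ))) := by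
  have hφ : DifferentiableAt ℝ bumpFn x := (contDiff_bumpFn.differentiable (by simp)) x
  simp only [testDatum]
  rw [show potential = fun y => bumpFn y • EuclideanSpace.single (2 : Fin 3) (1 : ℝ) from rfl,
    curl_eq_curlCLM, curlCLM_apply, fderiv_smul_const hφ]
  simp

/-- The test datum is not the zero field: along the `x₁`-axis `φ` drops from `1` (at `e₁`) to `0` (at
`2e₁`), so `∂₁φ` does not vanish identically there. -/
theorem testDatum_ne_zero : testDatum ≠ 0 := by
  intro h
  have h' : ∀ x, testDatum x = 0 := fun x => by rw [h]; rfl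
  -- `s ↦ φ(s e₁)` has zero derivative everywhere, hence is constant
  have hderiv : ∀ s : ℝ, HasDerivAt
      (fun r : ℝ => bumpFn (r • EuclideanSpace.single (0 : Fin 3) (1 : ℝ)))
      (fderiv ℝ bumpFn (s • EuclideanSpace.single (0 : Fin 3) (1 : ℝ))
        (EuclideanSpace.single (0 : Fin 3) (1 : ℝ))) s := fun s => by
    have hφ : DifferentiableAt ℝ bumpFn (s • EuclideanSpace.single (0 : Fin 3) (1 : ℝ)) :=
      (contDiff_bumpFn.differentiable (by simp)) _
    have hl : HasDerivAt (fun r : ℝ => r • EuclideanSpace.single (0 : Fin 3) (1 : ℝ))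
        ((1 : ℝ) • EuclideanSpace.single (0 : Fin 3) (1 : ℝ)) s :=
      (hasDerivAt_id s).smul_const _
    have := hφ.hasFDerivAt.comp_hasDerivAt s hl
    simpa [Function.comp_def] using this
  have hzero : ∀ s : ℝ, fderiv ℝ bumpFn (s • EuclideanSpace.single (0 : Fin 3) (1 : ℝ))
      (EuclideanSpace.single (0 : Fin 3) (1 : ℝ)) = 0 := fun s => by
    have h1 := congrArg (fun v : EuclideanSpace ℝ (Fin 3) => v 1)
      (h' (s • EuclideanSpace.single (0 : Fin 3) (1 : ℝ)))
    simp only [testDatum_apply_one, PiLp.zero_apply, neg_eq_zero] at h1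
    exact h1
  have hconst : ∀ a b : ℝ, bumpFn (a • EuclideanSpace.single (0 : Fin 3) (1 : ℝ)) =
      bumpFn (b • EuclideanSpace.single (0 : Fin 3) (1 : ℝ)) :=
    is_const_of_deriv_eq_zero (fun s => (hderiv s).differentiableAt)
      (fun s => by rw [(hderiv s).deriv, hzero])
  have h1 : bumpFn ((1 : ℝ) • EuclideanSpace.single (0 : Fin 3) (1 : ℝ)) = 1 := by
    apply bump.one_of_mem_closedBall
    simp [bump]
  have h2 : bumpFn ((2 : ℝ) • EuclideanSpace.single (0 : Fin 3) (1 : ℝ)) = 0 := by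
    apply bump.zero_of_le_dist
    simp [bump, norm_smul]
  have := hconst 1 2
  rw [h1, h2] at this
  exact one_ne_zero this

/-! ### The witness: a small multiple of the test datum carries a global smooth bounded-energy solution -/

/-- **Witness.** For every `ν > 0` there is a nonzero datum `u₀` together with `(u, p)` in the
skeleton's `Setting ν u₀ u p` (smooth, rapidly decaying, divergence-free datum; `(u, p)` smooth on
`[0,∞) × ℝ³`, solving the unforced system with datum `u₀`, bounded energy): `u₀ = c • curl(φ e₃)` with
`0 < c ≤` Kato's small-data threshold (tree: `exists_clayA_smul`, Kato 1984 Thm. 2).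
[cite: Kato1984MathZ, Thm. 2 (p. 472)] -/
theorem exists_setting_ne_zero {ν : ℝ} (hν : 0 < ν) :
    ∃ (u₀ : EuclideanSpace ℝ (Fin 3) → EuclideanSpace ℝ (Fin 3))
      (u : ℝ → EuclideanSpace ℝ (Fin 3) → EuclideanSpace ℝ (Fin 3))
      (p : ℝ → EuclideanSpace ℝ (Fin 3) → ℝ), u₀ ≠ 0 ∧ Setting ν u₀ u p := by
  have hdec : HasRapidSpatialDecay testDatum :=
    HasRapidSpatialDecay.of_hasCompactSupport contDiff_testDatum hasCompactSupport_testDatum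
  obtain ⟨c₀, hc₀, h⟩ := Literature.Barriers.NavierStokesRegularity.exists_clayA_smul hν
    contDiff_testDatum isDivFree_testDatum hdec
  obtain ⟨u, p, hu, hp, hsol, hE⟩ := h c₀ (by rw [abs_of_pos hc₀])
  have hsm : ContDiff ℝ ∞ (c₀ • testDatum) := contDiff_testDatum.const_smul c₀
  have hcs : HasCompactSupport (c₀ • testDatum) :=
    hasCompactSupport_testDatum.smul_left (f := fun _ : EuclideanSpace ℝ (Fin 3) => c₀)
  refine ⟨c₀ • testDatum, u, p, smul_ne_zero hc₀.ne' testDatum_ne_zero,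
    ⟨hν, hsm, HasRapidSpatialDecay.of_hasCompactSupport hsm hcs,
      VectorCalculus.IsDivFree.const_smul (contDiff_testDatum.differentiable (by simp))
        isDivFree_testDatum c₀, hsol, hu, hp, hE⟩⟩

/-! ### Packaging: any `Setting` solution with `u₀ ≠ 0` refutes Step 3 -/

/-- In the `Setting`, a nonzero datum has `b u 0 ≠ 0` — contrapositive of the skeleton's Step 7
(Theorem 2.5 p. 25), kernel-discharged by the cell's salvage prover (`step7_dataZero_holds`). -/
theorem b_zero_ne_zero {ν : ℝ} {u₀ : EuclideanSpace ℝ (Fin 3) → EuclideanSpace ℝ (Fin 3)}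
    {u : ℝ → EuclideanSpace ℝ (Fin 3) → EuclideanSpace ℝ (Fin 3)}
    {p : ℝ → EuclideanSpace ℝ (Fin 3) → ℝ} (hS : Setting ν u₀ u p) (hne : u₀ ≠ 0) : b u 0 ≠ 0 :=
  fun hb => hne (step7_dataZero_holds ν u₀ u p hS hb)

/-- **¬ Step 3 from one solution with `b u 0 ≠ 0`** (W2 lower bound near `t = 0⁺`, W3 upper bound on
`b₀`, and the Laplace core `false_of_hyperSingular`; the finiteness of `gradNorm (u t)` that W2 needs is
part of Step 3's own conclusion `HyperSingularIneq`). -/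
theorem not_step3_of_smooth_witness {ν : ℝ} {u₀ : EuclideanSpace ℝ (Fin 3) → EuclideanSpace ℝ (Fin 3)}
    {u : ℝ → EuclideanSpace ℝ (Fin 3) → EuclideanSpace ℝ (Fin 3)}
    {p : ℝ → EuclideanSpace ℝ (Fin 3) → ℝ} (hS : Setting ν u₀ u p) (hb : b u 0 ≠ 0) :
    ¬ Step3_hyperSingularIneq := by
  intro h3
  obtain ⟨c, hc, hall⟩ := h3 ν u₀ hS.viscosity_pos hS.data_smooth hS.data_decay hS.data_divFree
  obtain ⟨w, hphi, hineq⟩ := hall u p hS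
  obtain ⟨β, δ, hβ, hδ, hlow⟩ := b_lower_bound hS.velocity_smooth hb
  obtain ⟨B, hB⟩ := b₀_le hS.data_smooth hS.data_decay hS.viscosity_pos
  refine false_of_hyperSingular (b := b u) (b0 := b₀ ν u₀) (w := w) (k := c * c₁) (B := B)
    (mul_c₁_pos hc) hβ hδ (fun t _ => b_nonneg u t) hB
    (fun t ht => hlow t ht (hineq t ht.1).1) ?_ ?_
  · intro q hq
    exact hphi.2 q hq
  · intro t ht
    have := (hineq t ht).2
    linarith

/-- **¬ Step 3 from a bare witness**: any `Setting ν u₀ u p` with `u₀ ≠ 0` refutes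
`Step3_hyperSingularIneq`. -/
theorem not_step3_of_setting {ν : ℝ} {u₀ : EuclideanSpace ℝ (Fin 3) → EuclideanSpace ℝ (Fin 3)}
    {u : ℝ → EuclideanSpace ℝ (Fin 3) → EuclideanSpace ℝ (Fin 3)}
    {p : ℝ → EuclideanSpace ℝ (Fin 3) → ℝ} (hS : Setting ν u₀ u p) (hne : u₀ ≠ 0) :
    ¬ Step3_hyperSingularIneq :=
  not_step3_of_smooth_witness hS (b_zero_ne_zero hS hne)

/-! ### Verdict theorems -/

/-- **FIRST FAILING STEP (C04 `Ramm2024`): Step 3 is false.** The typed inequality (1.19) p. 22 ≡ (1.29)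
p. 23 — for every admissible datum a constant `c > 0` such that every solution in the setting satisfies
`b(t) ≤ b₀(t) − c·c₁·(Φ_{−1/4} ⋆ b)(t)` for all `t > 0` — fails for the Kato solution with the nonzero datum
`c₀ • curl(φ e₃)` at viscosity `ν = 1`: its `b` stays above some `β > 0` on an initial time interval while
`b₀` is bounded, and the Laplace transform of (1.29) then forces `β ≤ 0`. Class: false lemma
(countermodel). [cite: Ramm2024, (1.19) p. 22, (1.29) p. 23] -/
theorem not_Step3_hyperSingularIneq : ¬ Step3_hyperSingularIneq := by
  obtain ⟨u₀, u, p, hne, hS⟩ := exists_setting_ne_zero one_pos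
  exact not_step3_of_setting hS hne

/-- **Downstream: Step 6 (Theorem 2.3 p. 25, «b(0) = 0») is false** as a statement about all solutions
in the setting: the witness has `b(0) = (2π)^{−3/2}‖∇u₀‖₂ ≠ 0`. [cite: Ramm2024, Thm 2.3 p. 25] -/
theorem not_Step6_bZero : ¬ Step6_bZero := by
  intro h6
  obtain ⟨u₀, u, p, hne, hS⟩ := exists_setting_ne_zero one_pos
  exact b_zero_ne_zero hS hne (h6 1 u₀ u p hS)

/-- **Downstream: the claimed theorem (the «NSP paradox», box p. 23) is false as typed**: there IS a
nonzero smooth, rapidly decaying, divergence-free datum whose unforced Navier–Stokes problem has a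
solution in the paper's setting for all `t ≥ 0` (Kato's small-data global solution).
[cite: Ramm2024, box p. 23; Kato1984MathZ, Thm. 2] -/
theorem not_ClaimedTheorem : ¬ Literature.Claims.NS.Ramm2024.ClaimedTheorem := by
  intro hC
  obtain ⟨u₀, u, p, hne, hS⟩ := exists_setting_ne_zero one_pos
  exact hne (hC 1 u₀ u p hS)

/-- The datum-existence hypothesis of the skeleton's Clay link `clay_of_claimed` (Δ8) is met by the test
datum: IF the claimed theorem held, Clay (C) (`Literature.Claims.NS.ClayVariants.clayR3.Breakdown`) would follow. (It does
not hold: `not_ClaimedTheorem`.) [cite: Ramm2024, §3 p. 26] -/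
theorem clayBreakdown_of_claimedTheorem (h : ClaimedTheorem) :
    Literature.Claims.NS.ClayVariants.clayR3.Breakdown :=
  clay_of_claimed ⟨testDatum, testDatum_ne_zero, contDiff_testDatum, isDivFree_testDatum,
    HasRapidSpatialDecay.of_hasCompactSupport contDiff_testDatum hasCompactSupport_testDatum⟩ h

end Summit.NavierStokesRegularity.NavierStokesRegularity.Theorems.Ramm2024

end

-- WHAT THIS IS NOT: not a claim about NS regularity or blow-up; not a claim about any author beyond the
-- typed locator.
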